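import Summits.AtomisticToContinuum.HydrodynamicLimit.Theses.CollisionIsometryCLT

/-!
# Line `tagged-frame-sector-contraction` for the crux `AdaptedWeightCLT` (stmt-AtomisticToContinuum-12949)

Route `CollisionIsometryCLT`, crux rank 2 (`∀ profiles ∃ σ₀ ∀ σ < σ₀ ∀ Φ, H1 → H2 → C`): diffuse rows
of the exact collision-isometry transfer (H1) and time-averaged exponential velocity moments (H2) imply
that the block traceless kinetic stress `D` and kinetic heat flux `q` vanish in `L²([0,t] × 𝕋³)` in
probability (C = conclusion of the target `FastMomentRelaxation`).

## The lever (crux idea card `tagged-frame-sector-contraction`, triage r1-1/2/3: pass)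

Unroll ONE sphere along its OWN collisions: at each own collision with normal `n` and partner `j` the
typed fold does `vᵢ ↦ P⊥(n) vᵢ + ⟪vⱼ, n̂⟫ n̂` — the sphere keeps its tangential velocity and receives the
partner's normal momentum `π = ⟪vⱼ, n̂⟫` (a scalar). Over a window, `vᵢ(s) = Aᵢ vᵢ(s₀) + Σ_c π_c w_c`
with `Aᵢ` the product of the own projections (MEMORY) and frame vectors `w_c` obeying the exact PARSEVAL
identity `AᵢAᵢᵀ + Σ_c w_c w_cᵀ = 1` (the one-sphere Lindeberg normalisation; `|w_last| = 1`, so no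
one-sphere CLT exists — and none is needed). The crux's conclusion only sees the `ℓ ≥ 1` velocity
sectors of the block velocity law (traceless second moments, third-moment vector), which vanish on
EVERY radial law, Maxwellian or not. The line: (i) the memory is killed by the own collisions (H1's
job); (ii) the kicks a sphere receives from its block are, at second order, those of the LINEAR
hard-sphere process driven by the block's own velocity law (tagged/linear chaos — the load-bearing
input); (iii) that linear bath→tagged map CONTRACTS the `ℓ ≥ 1` sectors strictly (`c < 1`: no `ℓ ≥ 1`
pair collision invariant survives recentring; measured static ratios `c₂ = 0.25`, `c₃ = 0.57 ± 0.12`,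
kit j008306); (iv) self-consistency — the bath IS the population of tagged spheres — turns contraction
into decay by a delay-inequality (Halanay) argument over kinetic windows: `X ≤ c·sup_window X + o(1)`
forces `X → 0`. Boltzmann's rigidity restricted to the sectors the crux sees; no Gaussianity, no
factorisation of the collision measure, no entropy functional.

## The skeleton (5 stubs ⟹ crux; composition `AdaptedWeightCLT_of` kernel-checked)

* `stub_frame`           — the one-sphere kick recursion of the typed fold + Parseval (algebra, TRUE, M).
* `stub_linearSector`    — sector contraction of the LINEAR process in a time-dependent tight bath (L).
* `stub_kickContraction` — windowed contraction of the mean block an-isotropy along the flow, net of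
  rings, given H1/H2 (= linear chaos in contraction currency; load-bearing, hardest, XL).
* `stub_memory`          — H1 ⇒ the own-projection products forget, in time average (M/L).
* `stub_reduction`       — contraction + memory loss + H2 ⇒ C (delay-inequality decay in
  time-integrated form, then `D`, `q` from the an-isotropy with tails paid by H2; TRUE analysis, L).

Currency: `aniso μ` = quadratically weighted bounded-Lipschitz distance of the block velocity law to
the RADIAL laws (infimum over centres); `X_N(s) = E ∫ₓ aniso(μ_x(Φ_s z)) dx` (lower integrals, values
in `[0, ∞]`, bounded by energy). Quadratic weights only: pointwise-in-time velocity moments beyond the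
energy are not available (HighMomentumCutoff); everything of higher order is paid time-integrated by
H2 inside `stub_reduction`.

## Disproof used (`Cruxes/AdaptedWeightCLT/Disproof.lean`, cycle 1: NO KILL, no `_false_without_`)

H1 is USED at `stub_memory` (and available to `stub_kickContraction`): `ipr_of_collisionCount_eq_zero`
(a collision-free row has `ipr = 9`) and `reflectVel_of_inner_eq_zero` (coplanar normals freeze a
component of the sphere AND of its row) are exactly the degenerate cases of memory loss; H2 is USED at
`stub_kickContraction` and `stub_reduction`. Mechanism toys (landed as
`Theorems/AdaptedWeightCLT/Negative/MechanismToys.lean`): I1 `diffuse_rows_need_not_isotropise` —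
isotropy is never inferred from ipr here (it comes from sector contraction of the kicks); I2
`adapted_unit_rows_need_not_centre` — no CLT is run; the chaos input is named (`stub_kickContraction`)
and confined to second-order kick statistics of one sphere; S4 `one_reflection_covariance` — no stub
claims per-step isotropy (one kick injects `(θⱼ-θᵢ)ωωᵀ`; contraction is claimed per WINDOW of
`n_N → ∞` own collisions); §4 `self/partner_weight_after_reflection` (`3 = 2 + 1`) is the one-step
case of the Parseval identity in `stub_frame`. No stub is an instance of a landed Negative lemma.

See the line card `Lines/tagged-frame-sector-contraction.md`.
-/

namespace Summit.AtomisticToContinuum.HydrodynamicLimit.Cruxes.AdaptedWeightCLT.TaggedFrameSectorContraction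

open scoped BigOperators Topology Classical MeasureTheory ENNReal InnerProductSpace NNReal
open Filter Set MeasureTheory

noncomputable section

/-! ## Types -/

/-- Phase space of `N + 1` spheres on `𝕋³` (the crux's configuration type). -/
abbrev Cfg (N : ℕ) : Type :=
  Literature.Analysis.FluidPDE.Config (N + 1) (Fin 3) (UnitAddTorus (Fin 3))

/-- One-particle velocity space `ℝ³`. -/
abbrev V3 : Type := EuclideanSpace ℝ (Fin 3)

/-- The macroscopic torus `𝕋³`. -/
abbrev T3 : Type := UnitAddTorus (Fin 3)

/-- Velocity fields of `N + 1` spheres. -/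
abbrev Vel (N : ℕ) : Type := Fin (N + 1) → V3

/-- Families of hard-sphere flows at reduced density `σ` (the crux's `Φ`). -/
abbrev Flows (σ : ℝ) : Type :=
  (N : ℕ) → Literature.Analysis.FluidPDE.HardSphereFlow
    (Literature.Analysis.FluidPDE.Torus.geometry (Fin 3))
    (Literature.MathematicalPhysics.KineticTheory.hsDiameter σ N) (N + 1)

/-! ## The typed transfer of the crux (verbatim `let M`, `let ipr`) -/

/-- The frozen-geometry velocity transfer of the crux (verbatim the body of its `let M`). -/
def transfer (σ : ℝ) (N : ℕ) (y : Cfg N) (Δ : ℝ) (W : Vel N) : Vel N :=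
  (let G := Literature.Analysis.FluidPDE.Torus.geometry (Fin 3); let ε : ℝ := Literature.MathematicalPhysics.KineticTheory.hsDiameter σ N; let pre := fun k : ℕ => (let zk := Literature.Analysis.FluidPDE.Alexander.stateAfter G ε y k; Literature.Analysis.FluidPDE.freeFlight G (Literature.Analysis.FluidPDE.Alexander.freeExitTime G ε zk).toReal zk); (List.range (Literature.Analysis.FluidPDE.Alexander.collisionCount G ε y Δ)).foldl (fun W' k => @dite (Fin (N + 1) → EuclideanSpace ℝ (Fin 3)) (Literature.Analysis.FluidPDE.Alexander.incomingPairs G ε (pre k)).Nonempty (Classical.propDecidable _) (fun h => fun i => (Literature.Analysis.FluidPDE.collidePair G h.some.1 h.some.2 (fun j => ((pre k j).1, W' j)) i).2) (fun _ => W')) W)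

/-- The mean inverse participation ratio of the rows of `transfer` (verbatim the crux's `let ipr`). -/
def ipr (σ : ℝ) (N : ℕ) (y : Cfg N) (Δ : ℝ) : ℝ :=
  ((N + 1 : ℕ) : ℝ)⁻¹ * ∑ i : Fin (N + 1), ∑ k : Fin (N + 1),
    (∑ a : Fin 3, ‖transfer σ N y Δ (Pi.single k (EuclideanSpace.single a (1 : ℝ))) i‖ ^ 2) ^ 2


/-! ## The same transfer, step by step -/

/-- The pre-collisional configuration ending the `k`-th free flight of the Alexander construction
started at `y` (the crux's `pre k`, verbatim). -/
def pre (σ : ℝ) (N : ℕ) (y : Cfg N) (k : ℕ) : Cfg N :=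
  Literature.Analysis.FluidPDE.freeFlight (Literature.Analysis.FluidPDE.Torus.geometry (Fin 3))
    (Literature.Analysis.FluidPDE.Alexander.freeExitTime
      (Literature.Analysis.FluidPDE.Torus.geometry (Fin 3))
      (Literature.MathematicalPhysics.KineticTheory.hsDiameter σ N)
      (Literature.Analysis.FluidPDE.Alexander.stateAfter
        (Literature.Analysis.FluidPDE.Torus.geometry (Fin 3))
        (Literature.MathematicalPhysics.KineticTheory.hsDiameter σ N) y k)).toReal
    (Literature.Analysis.FluidPDE.Alexander.stateAfter
      (Literature.Analysis.FluidPDE.Torus.geometry (Fin 3))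
      (Literature.MathematicalPhysics.KineticTheory.hsDiameter σ N) y k)

/-- One fold step of the crux's transfer: the velocity part of `collidePair` at the realised
incoming pair of `pre k` (the identity if there is none), applied to a velocity field `W` placed at
the positions of `pre k` (verbatim the crux's `fun W' k => dite …`). -/
def stepMap (σ : ℝ) (N : ℕ) (y : Cfg N) (k : ℕ) (W : Vel N) : Vel N :=
  @dite (Fin (N + 1) → EuclideanSpace ℝ (Fin 3))
    (Literature.Analysis.FluidPDE.Alexander.incomingPairs
      (Literature.Analysis.FluidPDE.Torus.geometry (Fin 3))
      (Literature.MathematicalPhysics.KineticTheory.hsDiameter σ N) (pre σ N y k)).Nonempty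
    (Classical.propDecidable _)
    (fun h => fun i => (Literature.Analysis.FluidPDE.collidePair
      (Literature.Analysis.FluidPDE.Torus.geometry (Fin 3)) h.some.1 h.some.2
      (fun j => ((pre σ N y k j).1, W j)) i).2)
    (fun _ => W)

/-- The transfer after the first `m` fold steps, `M(m) W`. -/
def transferSteps (σ : ℝ) (N : ℕ) (y : Cfg N) (m : ℕ) (W : Vel N) : Vel N :=
  (List.range m).foldl (fun W' k => stepMap σ N y k W') W

/-- The number of fold steps whose collision instant lies in the closed window `[0, s]`
(the crux's `collisionCount`). -/
def steps (σ : ℝ) (N : ℕ) (y : Cfg N) (s : ℝ) : ℕ :=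
  Literature.Analysis.FluidPDE.Alexander.collisionCount
    (Literature.Analysis.FluidPDE.Torus.geometry (Fin 3))
    (Literature.MathematicalPhysics.KineticTheory.hsDiameter σ N) y s

/-- The crux's transfer over the window `[0, Δ]` is the step-wise transfer run for `steps σ N y Δ`
steps (`ζδ`-reduction). -/
theorem transfer_eq_transferSteps (σ : ℝ) (N : ℕ) (y : Cfg N) (Δ : ℝ) (W : Vel N) :
    transfer σ N y Δ W = transferSteps σ N y (steps σ N y Δ) W := rfl

/-- The incoming pair reflected at fold step `k` (`none` if the step is the identity). -/
def stepPair (σ : ℝ) (N : ℕ) (y : Cfg N) (k : ℕ) : Option (Fin (N + 1) × Fin (N + 1)) :=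
  @dite (Option (Fin (N + 1) × Fin (N + 1)))
    (Literature.Analysis.FluidPDE.Alexander.incomingPairs
      (Literature.Analysis.FluidPDE.Torus.geometry (Fin 3))
      (Literature.MathematicalPhysics.KineticTheory.hsDiameter σ N) (pre σ N y k)).Nonempty
    (Classical.propDecidable _)
    (fun h => some h.some) (fun _ => none)

/-- The partner of particle `i` at fold step `k` (`none` if `i` does not take part in the step). -/
def partner (σ : ℝ) (N : ℕ) (y : Cfg N) (k : ℕ) (i : Fin (N + 1)) : Option (Fin (N + 1)) :=
  match stepPair σ N y k with
  | none => none
  | some pq => if i = pq.1 then some pq.2 else if i = pq.2 then some pq.1 else none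

/-- The OWN collision normal of particle `i` at fold step `k`: the (unnormalised, length `ε`)
separation vector of the reflected pair's pre-collisional positions if `i` takes part in the step,
`0` otherwise. The reflection law only depends on the line it spans. -/
def ownNormal (σ : ℝ) (N : ℕ) (y : Cfg N) (k : ℕ) (i : Fin (N + 1)) : V3 :=
  match stepPair σ N y k with
  | none => 0
  | some pq => if i = pq.1 ∨ i = pq.2 then
      (Literature.Analysis.FluidPDE.Torus.geometry (Fin 3)).sepVec (pre σ N y k pq.1).1 (pre σ N y k pq.2).1
      else 0

/-- Orthogonal projection of `u` onto the plane `n^⊥` (the identity for `n = 0`):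
the part of its own velocity a sphere KEEPS in a collision with normal `n`. -/
def projPerp (n u : V3) : V3 := u - (⟪u, n⟫_ℝ / ‖n‖ ^ 2) • n

/-- The MEMORY OPERATOR of particle `i` over the first `m` fold steps applied to `u`:
`A_i(m) u = P⊥(n_{last}) ⋯ P⊥(n_{first}) u`, the product of the projections at `i`'s OWN collisions
(steps in which `i` does not take part contribute the identity, `ownNormal = 0`). -/
def memoryMap (σ : ℝ) (N : ℕ) (y : Cfg N) (m : ℕ) (i : Fin (N + 1)) (u : V3) : V3 :=
  (List.range m).foldl (fun u k => projPerp (ownNormal σ N y k i) u) u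

/-- The adjoint memory operator `A_i(m)ᵀ e = P⊥(n_{first}) ⋯ P⊥(n_{last}) e` (projections are
self-adjoint; the order is reversed). -/
def memoryMapT (σ : ℝ) (N : ℕ) (y : Cfg N) (m : ℕ) (i : Fin (N + 1)) (e : V3) : V3 :=
  (List.range m).foldr (fun k e => projPerp (ownNormal σ N y k i) e) e

/-- Squared Frobenius norm `‖A_i(m)‖_F² = Σₐ ‖A_i(m) eₐ‖² ∈ [0, 3]` of the memory operator
(`≥ ‖A_i(m)‖_op²`; `3` on a window without own collision, `2` after one own collision). -/
def memFrob (σ : ℝ) (N : ℕ) (y : Cfg N) (m : ℕ) (i : Fin (N + 1)) : ℝ :=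
  ∑ a : Fin 3, ‖memoryMap σ N y m i (EuclideanSpace.single a (1 : ℝ))‖ ^ 2

/-- The KICK part of particle `i`'s transferred velocity: everything but the memory of its own
initial velocity, `k_i(m) = (M(m) W)_i - A_i(m) W_i` (by the frame expansion, `Σ_c π_c w_c`). -/
def kick (σ : ℝ) (N : ℕ) (y : Cfg N) (m : ℕ) (i : Fin (N + 1)) (W : Vel N) : V3 :=
  transferSteps σ N y m W i - memoryMap σ N y m i (W i)


/-! ## The crux's hypotheses and conclusion at fixed `(σ, profiles, Φ)` (verbatim sub-formulas) -/

/-- Continuous, positive profiles (the crux's hypotheses on `a₀, θ₀, u₀`). -/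
def NiceProfiles (a₀ θ₀ : T3 → ℝ) (u₀ : T3 → V3) : Prop :=
  Continuous a₀ ∧ Continuous θ₀ ∧ Continuous u₀ ∧ (∀ x, 0 < a₀ x) ∧ (∀ x, 0 < θ₀ x)

/-- Admissible kinetic windows (the crux's hypotheses on `Δ`): `Δ_N > 0`, `Δ_N → 0`,
`Δ_N (N+1)^{1/3} → ∞` (`n_N → ∞` collisions per particle per window). -/
def AdmissibleWindow (Δ : ℕ → ℝ) : Prop :=
  (∀ N, 0 < Δ N) ∧ Tendsto Δ atTop (𝓝 0) ∧
    Tendsto (fun N : ℕ => Δ N * ((N + 1 : ℕ) : ℝ) ^ ((1 : ℝ) / 3)) atTop atTop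

/-- Admissible kernel families at mesoscale `(N+1)^{-γ}` (verbatim the crux's kernel hypotheses). -/
def AdmissibleKernel (γ C : ℝ) (φ : ℕ → T3 → ℝ) : Prop :=
  0 < γ ∧ γ ≤ 1 / 15 ∧ ((∀ N, Literature.Analysis.FunctionSpaces.Torus.IsSmooth (φ N)) ∧ (∀ N y, 0 ≤ φ N y) ∧ (∀ N, ∫ y, φ N y = 1) ∧ (∀ (N : ℕ) y, ((N : ℝ) + 1) ^ (-γ) ≤ Literature.Analysis.FluidPDE.Torus.euclidDist y 0 → φ N y = 0) ∧ (∀ (N : ℕ) y, φ N y ≤ C * ((N : ℝ) + 1) ^ (3 * γ)) ∧ (∀ (N : ℕ) y, ‖Literature.Analysis.FunctionSpaces.Torus.gradient (φ N) y‖ ≤ C * ((N : ℝ) + 1) ^ (4 * γ)))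

/-- H1 at `(σ, profiles, Φ)`: the conclusion of `DiffuseBackwardInfluence` — on every admissible
window the rows of the transfer delocalise in local-Gibbs mean (verbatim the crux's first
hypothesis, with `let M; let ipr` replaced by the named `transfer`/`ipr`). -/
def DiffuseAt (σ : ℝ) (a₀ θ₀ : T3 → ℝ) (u₀ : T3 → V3) (Φ : Flows σ) : Prop :=
  ∀ Δ : ℕ → ℝ, (∀ N, 0 < Δ N) → Tendsto Δ atTop (𝓝 0) → Tendsto (fun N : ℕ => Δ N * ((N + 1 : ℕ) : ℝ) ^ ((1 : ℝ) / 3)) atTop atTop → ∀ t : ℝ, 0 < t → Tendsto (fun N : ℕ => ∫⁻ z, ENNReal.ofReal (ipr σ N ((Φ N).flow (t - Δ N) z) (Δ N)) ∂(Literature.MathematicalPhysics.KineticTheory.localGibbsLaw σ a₀ u₀ θ₀ N (Φ N))) atTop (𝓝 0)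

/-- H2 at `(σ, profiles, Φ)`: component (i) of `AprioriBounds` — a time-averaged one-particle
exponential velocity moment is bounded with probability `→ 1` (verbatim the crux's second
hypothesis). -/
def TailsAt (σ : ℝ) (a₀ θ₀ : T3 → ℝ) (u₀ : T3 → V3) (Φ : Flows σ) : Prop :=
  ∀ t : ℝ, 0 < t → ∃ lam Cexp : ℝ, 0 < lam ∧ Tendsto (fun N : ℕ => Literature.MathematicalPhysics.KineticTheory.localGibbsLaw σ a₀ u₀ θ₀ N (Φ N) {z | Cexp < ∫ s in Icc 0 t, ∫ y, Real.exp (lam * ‖y.2‖ ^ 2) ∂(Literature.Analysis.FluidPDE.empiricalMeasure ((Φ N).flow s z))}) atTop (𝓝 0)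

/-- The conclusion C of the crux at `(σ, profiles, Φ)` and a FIXED kernel family `(γ, C, φ)`:
for every `t > 0` the block traceless kinetic stress and kinetic heat flux vanish in
`L²([0,t] × 𝕋³)` in probability (verbatim the crux's `let ρb …; ∀ t … Tendsto …`). -/
def ClosureAt (σ : ℝ) (a₀ θ₀ : T3 → ℝ) (u₀ : T3 → V3) (Φ : Flows σ) (φ : ℕ → T3 → ℝ) : Prop :=
  let ρb := fun (N : ℕ) (s : ℝ) z (x : UnitAddTorus (Fin 3)) => Literature.MathematicalPhysics.KineticTheory.empiricalDensityField ((Φ N).flow s z) (fun y => φ N (y - x)); let mb := fun (N : ℕ) (s : ℝ) z (x : UnitAddTorus (Fin 3)) => Literature.MathematicalPhysics.KineticTheory.empiricalMomentumField ((Φ N).flow s z) (fun y => φ N (y - x)); let ub := fun (N : ℕ) (s : ℝ) z (x : UnitAddTorus (Fin 3)) => (ρb N s z x)⁻¹ • mb N s z x; let D := fun (N : ℕ) (s : ℝ) z (x : UnitAddTorus (Fin 3)) (j k : Fin 3) => (∫ y, φ N (y.1 - x) * ((y.2 j - ub N s z x j) * (y.2 k - ub N s z x k)) ∂(Literature.Analysis.FluidPDE.empiricalMeasure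 ((Φ N).flow s z))) - (if j = k then (∑ l : Fin 3, ∫ y, φ N (y.1 - x) * (y.2 l - ub N s z x l) ^ 2 ∂(Literature.Analysis.FluidPDE.empiricalMeasure ((Φ N).flow s z))) / 3 else 0); let q := fun (N : ℕ) (s : ℝ) z (x : UnitAddTorus (Fin 3)) => ∫ y, (φ N (y.1 - x) * ‖y.2 - ub N s z x‖ ^ 2 / 2) • (y.2 - ub N s z x) ∂(Literature.Analysis.FluidPDE.empiricalMeasure ((Φ N).flow s z)); ∀ t : ℝ, 0 < t → ∀ δ : ℝ, 0 < δ → Tendsto (fun N : ℕ => Literature.MathematicalPhysics.KineticTheory.localGibbsLaw σ a₀ u₀ θ₀ N (Φ N) {z | δ < ∫ s in Icc 0 t, ∫ x, ((∑ j, ∑ k, D N s z x j k ^ 2) + ‖q N s z x‖ ^ 2)}) atTop (𝓝 0)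

/-- Sanity check of the verbatim copies: the crux is, definitionally,
`∀ nice profiles ∃ σ₀ ∀ σ < σ₀ ∀ Φ, DiffuseAt → TailsAt → ∀ admissible kernels, ClosureAt`. -/
theorem adaptedWeightCLT_iff :
    Summit.AtomisticToContinuum.HydrodynamicLimit.Theses.CollisionIsometryCLT.AdaptedWeightCLT ↔
      ∀ (a₀ θ₀ : T3 → ℝ) (u₀ : T3 → V3), Continuous a₀ → Continuous θ₀ → Continuous u₀ →
        (∀ x, 0 < a₀ x) → (∀ x, 0 < θ₀ x) → ∃ σ₀ : ℝ, 0 < σ₀ ∧ ∀ σ : ℝ, 0 < σ → σ < σ₀ →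
          ∀ Φ : Flows σ, DiffuseAt σ a₀ θ₀ u₀ Φ → TailsAt σ a₀ θ₀ u₀ Φ →
            ∀ (γ C : ℝ) (φ : ℕ → T3 → ℝ), 0 < γ → γ ≤ 1 / 15 →
              ((∀ N, Literature.Analysis.FunctionSpaces.Torus.IsSmooth (φ N)) ∧ (∀ N y, 0 ≤ φ N y) ∧ (∀ N, ∫ y, φ N y = 1) ∧ (∀ (N : ℕ) y, ((N : ℝ) + 1) ^ (-γ) ≤ Literature.Analysis.FluidPDE.Torus.euclidDist y 0 → φ N y = 0) ∧ (∀ (N : ℕ) y, φ N y ≤ C * ((N : ℝ) + 1) ^ (3 * γ)) ∧ (∀ (N : ℕ) y, ‖Literature.Analysis.FunctionSpaces.Torus.gradient (φ N) y‖ ≤ C * ((N : ℝ) + 1) ^ (4 * γ))) →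
              ClosureAt σ a₀ θ₀ u₀ Φ φ :=
  Iff.rfl

/-! ## Block velocity laws and the an-isotropy functional (the contraction currency) -/

/-- The kernel-weighted VELOCITY LAW of the block around `x` in the configuration `z`:
`μ_x = (N+1)⁻¹ Σᵢ φ(xᵢ - x) δ_{vᵢ}`, a finite measure on `ℝ³` of mass `ρ̄(x)` whose first and
second moments are the block momentum `m̄(x)` and the block kinetic stress; the crux's `D(x)` and
`q(x)` are its traceless central second moment and its central third-moment vector. -/
def blockLaw {N : ℕ} (χ : T3 → ℝ) (z : Cfg N) (x : T3) : Measure V3 :=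
  Measure.map Prod.snd
    ((Literature.Analysis.FluidPDE.empiricalMeasure z).withDensity fun y => ENNReal.ofReal (χ (y.1 - x)))

/-- Test functions of quadratic growth about `u`, locally Lipschitz with linearly growing constant:
`|g(v)| ≤ 1 + |v-u|²`, `|g(v) - g(w)| ≤ (2 + |v-u| + |w-u|) |v-w|` (the class contains the centred
quadratic monomials and truncated cubics; it is invariant under rotations about `u`). -/
def IsQuadTest (u : V3) (g : V3 → ℝ) : Prop :=
  ∀ v w : V3, |g v| ≤ 1 + ‖v - u‖ ^ 2 ∧ |g v - g w| ≤ (2 + ‖v - u‖ + ‖w - u‖) * ‖v - w‖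

/-- The quadratically weighted bounded-Lipschitz distance of two measures on `ℝ³`, seen from the
centre `u`: `sup { |∫ g dμ - ∫ g dν| : g a quadratic test about u } ∈ [0, ∞]`. -/
def wDist (u : V3) (μ ν : Measure V3) : ℝ≥0∞ :=
  ⨆ g : {g : V3 → ℝ // IsQuadTest u g}, ENNReal.ofReal |(∫ v, g.1 v ∂μ) - ∫ v, g.1 v ∂ν|

/-- Radial symmetry of a measure on `ℝ³` about the centre `u` (invariance under every linear
isometry fixing `u`). Centred Maxwellians are radial; so is every isotropic non-Maxwellian speed
distribution — no Gaussianity is asked of a radial law. -/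
def IsRadialAbout (u : V3) (ν : Measure V3) : Prop :=
  ∀ R : V3 ≃ₗᵢ[ℝ] V3, Measure.map (fun v => u + R (v - u)) ν = ν

/-- The AN-ISOTROPY of a finite measure on `ℝ³`: its weighted distance to the radial laws of finite
second moment (infimum over centres `u` and radial `ν`). It vanishes exactly on radial laws, is
Galilean invariant, dominates the traceless central second moment and (after velocity truncation)
the central third-moment vector, and is bounded by the quadratic moment `∫ (1 + |v-u|²) dμ`
(take `ν = 0`). This is the `ℓ ≥ 1` sector content of `μ` — the only part of non-Maxwellianity the
crux's conclusion sees. -/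
def aniso (μ : Measure V3) : ℝ≥0∞ :=
  ⨅ p : {p : V3 × Measure V3 // IsFiniteMeasure p.2 ∧ IsRadialAbout p.1 p.2 ∧
      ∫⁻ v, ENNReal.ofReal (‖v - p.1‖ ^ 2) ∂p.2 < ∞}, wDist p.1.1 μ p.1.2

/-- The contraction currency along the flow: the local-Gibbs mean of the spatially integrated block
an-isotropy at time `s`, `X_N(s) = E ∫ₓ aniso(μ_x(Φ_s z)) dx ∈ [0, ∞]` (lower integrals; bounded by
`1 + 2 E[kinetic energy per particle]` uniformly in `N` and `s`). -/
def blockAniso (σ : ℝ) (a₀ θ₀ : T3 → ℝ) (u₀ : T3 → V3) (Φ : Flows σ) (φ : ℕ → T3 → ℝ) (N : ℕ)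
    (s : ℝ) : ℝ≥0∞ :=
  ∫⁻ z, ∫⁻ x, aniso (blockLaw (φ N) ((Φ N).flow s z) x)
    ∂volume ∂(Literature.MathematicalPhysics.KineticTheory.localGibbsLaw σ a₀ u₀ θ₀ N (Φ N))

/-- The GRID MEMORY functional: local-Gibbs mean of the particle-averaged squared Frobenius norm of
the memory operators over the `j`-th grid window `[jΔ_N, (j+1)Δ_N]` (Alexander construction
restarted at `Φ_{jΔ_N} z`, as H1 restarts it at `Φ_{t-Δ_N} z`), normalised to `[0, 1]`:
`G_N(j) = E (N+1)⁻¹ Σᵢ ‖A_i(window j)‖_F² / 3`. Pure geometry of the own normals — no velocity. -/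
def gridMemory (σ : ℝ) (a₀ θ₀ : T3 → ℝ) (u₀ : T3 → V3) (Φ : Flows σ) (Δ : ℕ → ℝ) (N j : ℕ) :
    ℝ≥0∞ :=
  ∫⁻ z, ENNReal.ofReal (((N + 1 : ℕ) : ℝ)⁻¹ *
      ∑ i : Fin (N + 1), memFrob σ N ((Φ N).flow ((j : ℝ) * Δ N) z)
        (steps σ N ((Φ N).flow ((j : ℝ) * Δ N) z) (Δ N)) i / 3)
    ∂(Literature.MathematicalPhysics.KineticTheory.localGibbsLaw σ a₀ u₀ θ₀ N (Φ N))

/-! ## The linear (tagged-sphere) hard-sphere collision process in a time-dependent bath -/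

/-- The generator of the LINEAR hard-sphere collision process of a tagged sphere in the bath `f`
(a finite measure on `ℝ³`: partners are drawn from `f`, normals with the hard-sphere flux weight
`((v - w)·ω)₊`), acting on a test function: `L_f g(v) = ∫∫ ((v-w)·ω)₊ (g(v') - g(v)) dω f(dw)`,
`v' = v - ((v-w)·ω) ω` the tagged outgoing velocity (`collide`). For `f = M dw` a Maxwellian this is
the linear Boltzmann operator of Bodineau–Gallagher–Saint-Raymond (tree: `linearCollisionTerm`). -/
def linGen (f : Measure V3) (g : V3 → ℝ) (v : V3) : ℝ :=
  ∫ w, (∫ ω, Literature.MathematicalPhysics.KineticTheory.hardSphereKernel (v, w) ω *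
      (g (Literature.MathematicalPhysics.KineticTheory.collide ω (v, w)).1 - g v)
    ∂Literature.MathematicalPhysics.KineticTheory.sphereMeasure) ∂f

/-- The TIGHT class of baths with parameters `(λ, Λ, m₋, m₊, θ₋)`: finite measures of mass in
`[m₋, m₊]`, centred, exponential velocity moment `∫ e^{λ|w|²} ≤ Λ · mass` (a LOWER integral: no
Bochner junk, so heavy-tailed baths are excluded), temperature floor `∫ |w|² ≥ θ₋ · mass` (collision
rates bounded below). -/
def TightBath (lam Λ mlo mhi θlo : ℝ) (f : Measure V3) : Prop :=
  IsFiniteMeasure f ∧ mlo ≤ (f univ).toReal ∧ (f univ).toReal ≤ mhi ∧ (∫ w, w ∂f) = 0 ∧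
    ∫⁻ w, ENNReal.ofReal (Real.exp (lam * ‖w‖ ^ 2)) ∂f ≤ ENNReal.ofReal (Λ * (f univ).toReal) ∧
    θlo * (f univ).toReal ≤ ∫ w, ‖w‖ ^ 2 ∂f

/-- A (weak, forward) solution on `[0, T]` of the linear collision process driven by the bath path
`f`: probability laws `h τ` of the tagged velocity with a uniform exponential moment on `[0, T]`
(lower integral: no Bochner junk), such that for every bounded Lipschitz test `g` the map
`τ ↦ ∫ g dh_τ` is continuous on `[0, T]` (so `h T` is the weak limit from the left, not a free value)
and has right derivative `∫ L_{f τ} g dh_τ` on `[0, T)` (Kolmogorov forward equation tested against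
`g`; with the exponential moments this determines `h` from `h 0`). -/
def IsLinearSolution (lam Λ' : ℝ) (f h : ℝ → Measure V3) (T : ℝ) : Prop :=
  (∀ τ, IsProbabilityMeasure (h τ)) ∧
  (∀ τ ∈ Icc 0 T, ∫⁻ v, ENNReal.ofReal (Real.exp (lam * ‖v‖ ^ 2)) ∂(h τ) ≤ ENNReal.ofReal Λ') ∧
  ∀ g : V3 → ℝ, (∀ v, |g v| ≤ 1) → LipschitzWith 1 g →
    ContinuousOn (fun τ' => ∫ v, g v ∂(h τ')) (Icc 0 T) ∧
    ∀ τ ∈ Ico 0 T, HasDerivWithinAt (fun τ' => ∫ v, g v ∂(h τ')) (∫ v, linGen (f τ) g v ∂(h τ)) (Ici τ) τ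

/-- LINEAR SECTOR CONTRACTION (the statement of `stub_sector`). For every tight class and every
moment level `Λ'` of the tagged law there are a contraction factor `c < 1`, a transient constant
`C` and a rate `κ > 0` such that: for every bath path in the class, every linear solution `h` on
`[0, T]` and every `A ≥ 0` bounding the baths' normalised an-isotropy on `[0, T]`, the tagged law
at time `T` has an-isotropy `≤ c · A + C e^{-κ T}`. The bath→tagged map contracts the `ℓ ≥ 1`
velocity sectors (no `ℓ ≥ 1` collision invariant survives recentring; hard-sphere gap), uniformly
on the class, for time-dependent baths (sup gain, not only the static ratio), around every radial
background (no Maxwellian reference). -/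
def LinearSectorContraction : Prop :=
  ∀ lam Λ mlo mhi θlo Λ' : ℝ, 0 < lam → 0 < mlo → mlo ≤ mhi → 0 < θlo →
    ∃ c C κ : ℝ, 0 ≤ c ∧ c < 1 ∧ 0 ≤ C ∧ 0 < κ ∧
      ∀ (T : ℝ) (f h : ℝ → Measure V3), 0 ≤ T → (∀ τ, TightBath lam Λ mlo mhi θlo (f τ)) →
        IsLinearSolution lam Λ' f h T →
        ∀ A : ℝ, 0 ≤ A → (∀ τ ∈ Icc 0 T, aniso (f τ) ≤ ENNReal.ofReal (A * ((f τ) univ).toReal)) →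
          aniso (h T) ≤ ENNReal.ofReal (c * A + C * Real.exp (-(κ * T)))


/-! ## The statements of the line -/

/-- FRAME LAW (the statement of `stub_frame`) — the typed fold seen from ONE sphere. For every
`σ, N, y`:
(A) one-step kick law: at a fold step in which `i` does not take part its transferred velocity is
unchanged (and `ownNormal = 0`); at an own collision with partner `j` and normal `n ≠ 0` it becomes
`P⊥(n) vᵢ + (⟪vⱼ, n⟫/|n|²) n` — the sphere KEEPS its tangential velocity and RECEIVES the partner's
normal momentum (`collidePair`/`reflectVel` unfolded along `List.range`);
(B) the memory operator and its reversed product are adjoint (projections are self-adjoint);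
(C) frame expansion: there are frame vectors `w_c` (`|w_c| ≤ 1`, the own normals projected by the
LATER own collisions; independent of the velocity field) such that the kick part is the frame sum of
the received normal momenta, `kᵢ(m) = Σ_c ⟪v_{j_c}(step c), n̂_c⟫ w_c`, with the PARSEVAL identity
`‖Aᵢ(m)ᵀ e‖² + Σ_c ⟪w_c, e⟫² = ‖e‖²` (one-sphere Lindeberg normalisation; `parsevalFrame_holds` of
IdeatorThreeSketch.lean is its matrix form). -/
def FrameLaw (σ : ℝ) : Prop :=
  ∀ (N : ℕ) (y : Cfg N),
    (∀ (k : ℕ) (i : Fin (N + 1)) (W : Vel N),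
      (partner σ N y k i = none →
        ownNormal σ N y k i = 0 ∧ transferSteps σ N y (k + 1) W i = transferSteps σ N y k W i) ∧
      (∀ j : Fin (N + 1), partner σ N y k i = some j →
        j ≠ i ∧ ownNormal σ N y k i ≠ 0 ∧
        transferSteps σ N y (k + 1) W i =
          projPerp (ownNormal σ N y k i) (transferSteps σ N y k W i) +
            (⟪transferSteps σ N y k W j, ownNormal σ N y k i⟫_ℝ / ‖ownNormal σ N y k i‖ ^ 2) •
              ownNormal σ N y k i)) ∧
    (∀ (m : ℕ) (i : Fin (N + 1)) (u e : V3),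
      ⟪memoryMap σ N y m i u, e⟫_ℝ = ⟪u, memoryMapT σ N y m i e⟫_ℝ) ∧
    (∀ (m : ℕ) (i : Fin (N + 1)),
      ∃ (n : ℕ) (w : Fin n → V3) (src : Fin n → ℕ) (ptr : Fin n → Fin (N + 1)),
        (∀ c, src c < m ∧ partner σ N y (src c) i = some (ptr c)) ∧
        (∀ c, ‖w c‖ ≤ 1) ∧
        (∀ e : V3, ‖memoryMapT σ N y m i e‖ ^ 2 + ∑ c, ⟪w c, e⟫_ℝ ^ 2 = ‖e‖ ^ 2) ∧
        (∀ W : Vel N, kick σ N y m i W =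
          ∑ c, (⟪transferSteps σ N y (src c) W (ptr c), ownNormal σ N y (src c) i⟫_ℝ /
            ‖ownNormal σ N y (src c) i‖) • w c))

/-- WINDOWED KICK CONTRACTION at `(σ, profiles, Φ, kernel family, Δ, t)` (the conclusion of
`stub_kickContraction`): there are a contraction factor `c < 1`, a memory constant `K`, a uniform
bound `B` and errors `ε_N → 0` such that for every `N`, every grid index `j ≥ 1` and every time
`s ∈ [jΔ_N, (j+1)Δ_N] ∩ [0, t]`,
  `X_N(s) ≤ c · sup_{s' ∈ [(j-1)Δ_N, s]} X_N(s') + K · G_N(j-1) + ε_N`,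
where `X_N` is the mean block an-isotropy (`blockAniso`) and `G_N(j-1)` the grid memory of the
window `[(j-1)Δ_N, jΔ_N]` (`gridMemory`); and `X_N(s) ≤ B` on `[0, t]`. Read: over the kinetic
window `[(j-1)Δ_N, s]` every sphere's velocity is (memory of its window-start velocity) + (kicks
received from its block's population); the kicks contract the block an-isotropy by `c`, net of rings,
up to `o(1)`. -/
def ContractsAt (σ : ℝ) (a₀ θ₀ : T3 → ℝ) (u₀ : T3 → V3) (Φ : Flows σ) (φ : ℕ → T3 → ℝ)
    (Δ : ℕ → ℝ) (t : ℝ) : Prop :=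
  ∃ c K B : ℝ, 0 ≤ c ∧ c < 1 ∧ 0 ≤ K ∧
    (∀ N : ℕ, ∀ s ∈ Icc 0 t, blockAniso σ a₀ θ₀ u₀ Φ φ N s ≤ ENNReal.ofReal B) ∧
    ∃ err : ℕ → ℝ≥0∞, Tendsto err atTop (𝓝 0) ∧
      ∀ (N j : ℕ) (s : ℝ), 1 ≤ j → (j : ℝ) * Δ N ≤ s → s ≤ ((j : ℝ) + 1) * Δ N → s ≤ t →
        blockAniso σ a₀ θ₀ u₀ Φ φ N s ≤
          ENNReal.ofReal c * (⨆ s' ∈ Icc (((j : ℝ) - 1) * Δ N) s, blockAniso σ a₀ θ₀ u₀ Φ φ N s') +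
            ENNReal.ofReal K * gridMemory σ a₀ θ₀ u₀ Φ Δ N (j - 1) + err N

/-- MEMORY VANISHES IN TIME AVERAGE at `(σ, profiles, Φ, Δ, t)` (the conclusion of `stub_memory`):
the Riemann sum `Δ_N Σ_{j ≤ t/Δ_N} G_N(j)` of the grid memory over `[0, t]` tends to `0`. -/
def MemoryVanishesAt (σ : ℝ) (a₀ θ₀ : T3 → ℝ) (u₀ : T3 → V3) (Φ : Flows σ) (Δ : ℕ → ℝ)
    (t : ℝ) : Prop :=
  Tendsto (fun N : ℕ => ENNReal.ofReal (Δ N) *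
    ∑ j ∈ Finset.range (⌊t / Δ N⌋₊ + 1), gridMemory σ a₀ θ₀ u₀ Φ Δ N j) atTop (𝓝 0)

/-! ## The five stub statements as named propositions -/

/-- Statement of `stub_frame`: the frame law at every reduced density. -/
def FrameLawAll : Prop := ∀ σ : ℝ, FrameLaw σ

/-- Statement of `stub_kickContraction` (windowed kick contraction along the flow, given the frame law
and linear sector contraction; H1 and H2 are hypotheses). -/
def KickContraction : Prop :=
  FrameLawAll → LinearSectorContraction →
    ∀ (a₀ θ₀ : T3 → ℝ) (u₀ : T3 → V3), NiceProfiles a₀ θ₀ u₀ →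
      ∃ σ₀ : ℝ, 0 < σ₀ ∧ ∀ σ : ℝ, 0 < σ → σ < σ₀ → ∀ Φ : Flows σ,
        DiffuseAt σ a₀ θ₀ u₀ Φ → TailsAt σ a₀ θ₀ u₀ Φ →
        ∀ (γ C : ℝ) (φ : ℕ → T3 → ℝ), AdmissibleKernel γ C φ →
          ∀ Δ : ℕ → ℝ, AdmissibleWindow Δ → ∀ t : ℝ, 0 < t →
            ContractsAt σ a₀ θ₀ u₀ Φ φ Δ t

/-- Statement of `stub_memory` (time-averaged memory loss, given the frame law; H1 is a hypothesis). -/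
def MemoryLoss : Prop :=
  FrameLawAll →
    ∀ (a₀ θ₀ : T3 → ℝ) (u₀ : T3 → V3), NiceProfiles a₀ θ₀ u₀ →
      ∃ σ₀ : ℝ, 0 < σ₀ ∧ ∀ σ : ℝ, 0 < σ → σ < σ₀ → ∀ Φ : Flows σ,
        DiffuseAt σ a₀ θ₀ u₀ Φ →
          ∀ Δ : ℕ → ℝ, AdmissibleWindow Δ → ∀ t : ℝ, 0 < t →
            MemoryVanishesAt σ a₀ θ₀ u₀ Φ Δ t

/-- Statement of `stub_reduction` (memory loss + kick contraction + H2 ⇒ C, kernel family by kernel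
family). -/
def Reduction : Prop :=
  ∀ (a₀ θ₀ : T3 → ℝ) (u₀ : T3 → V3), NiceProfiles a₀ θ₀ u₀ →
    ∀ σ : ℝ, 0 < σ → σ ≤ 1 / 2 → ∀ Φ : Flows σ, TailsAt σ a₀ θ₀ u₀ Φ →
      ∀ (γ C : ℝ) (φ : ℕ → T3 → ℝ), AdmissibleKernel γ C φ →
        (∀ Δ : ℕ → ℝ, AdmissibleWindow Δ → ∀ t : ℝ, 0 < t →
          MemoryVanishesAt σ a₀ θ₀ u₀ Φ Δ t ∧ ContractsAt σ a₀ θ₀ u₀ Φ φ Δ t) →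
        ClosureAt σ a₀ θ₀ u₀ Φ φ

/-! ## Registered stubs -/

/-- STUB 1 (FRAME LAW; deterministic algebra of the typed fold, TRUE, M). `FrameLaw σ` for every `σ`:
fold induction over `List.range` (`List.range_succ`, `List.foldl_append`), `collidePair_apply_left /
_right / _of_ne`, `reflectVel` rewritten as `P⊥(n) v + (⟪w, n⟫/|n|²) n`, the normal is nonzero
because the reflected pair is incoming (`⟪n, vᵢ - vⱼ⟫ < 0`), projections are self-adjoint
idempotents, and Parseval by induction (`P(AAᵀ + Σ w wᵀ)P + n̂n̂ᵀ = P + n̂n̂ᵀ = 1`; matrix form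
proved in `IdeatorThreeSketch.parsevalFrame_holds`). -/
theorem stub_frame : FrameLawAll := by
  sorry

/-- STUB 2 (LINEAR SECTOR CONTRACTION; kinetic theory of the LINEAR hard-sphere equation, L).
`LinearSectorContraction`: the tagged-sphere process driven by any centred tight bath path contracts
the `ℓ ≥ 1` velocity sectors — the an-isotropy of the tagged law at time `T` is at most `c · (sup of
the baths' normalised an-isotropy) + C e^{-κT}` with `c < 1` uniform on the class. Linearised
content: around a radial background the bath→tagged response preserves angular sectors, equals `1`
exactly on pair collision invariants (momentum: removed by recentring; energy: `ℓ = 0`, not seen by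
`aniso`) and has modulus `< 1` on every other mode (no `ℓ ≥ 1` invariant; relative compactness of
the gain; hard-sphere gap `hardSphereLinearizedOp_spectralGap_holds` at the Maxwellian point);
static sector ratios measured `c₂ = 0.25` (traceless stress), `c₃ = 0.57 ± 0.12` (heat flux) for
Gaussian/skewed baths (kit j008306). Why it might fail: the DYNAMIC (sup-over-the-past) gain of a
time-dependent bath can exceed the static ratio (transient amplification), and uniformity over the
tight class is a statement about `c(f)` as a functional of the whole bath law (rates depend on
`|g|`), not of its second moments (triage r1-3). -/
theorem stub_linearSector : LinearSectorContraction := by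
  sorry

/-- STUB 3 (WINDOWED KICK CONTRACTION ALONG THE FLOW = tagged/linear chaos including rings;
load-bearing, hardest, XL). Given the frame law and linear sector contraction: for all nice profiles
there is `σ₀ > 0` such that for `0 < σ < σ₀`, every flow family satisfying H1 and H2, every
admissible kernel family, admissible window and `t > 0`, `ContractsAt` holds — the mean block
an-isotropy at time `s` is at most `c ·` (its sup over the kinetic window `[(j-1)Δ_N, s]`) `+ K ·`
(grid memory) `+ o(1)`, with `c < 1` (the linear constant renormalised by rings/recollisions, an
`O(σ³)`-fraction of own collisions at small `σ` — hence `∃ σ₀`; the sum rules are exact at every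
density because Gibbs velocities are Maxwellian and configuration-independent). Content: over a
window of `n_N → ∞` own collisions the kicks a sphere receives from its block have, in the weak
second-order sense measured by `aniso`, the statistics of the linear process driven by the block's
own (time-dependent) velocity law — LINEAR (tagged) chaos, the one regime with a long-time precedent
(BGSR 2016, tree fact `bgsr_linearBoltzmannApprox`: equilibrium, Boltzmann–Grad); H1 supplies "all but
`o(N)` spheres collide in every window" (`ipr = 9` on collision-free rows), H2 the velocity tails,
`Δ_N (N+1)^γ → 0` the localisation of spheres in their blocks. Why it might fail: off-equilibrium
tagged chaos at FIXED `σ` over `n_N → ∞` collisions is open (BoltzmannHypothesis-class: absence of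
proof); and the `∀ t > 0` clause makes the inequality carry sub-block COHERENT anisotropy (mesoscale
shear band `N^{-1/6} ≪ ℓ ≪ N^{-γ}`, invisible to kicks; triage F1/F2): physically `o(1)` pre-shock,
no handle post-shock. -/
theorem stub_kickContraction : KickContraction := by
  sorry

/-- STUB 4 (MEMORY LOSS; M/L). Given the frame law: for all nice profiles there is `σ₀ > 0` such that
for `0 < σ < σ₀` and every flow family satisfying H1, on every admissible window grid the
time-averaged grid memory vanishes, `Δ_N Σ_{j ≤ t/Δ_N} E[(N+1)⁻¹ Σᵢ ‖Aᵢ(window j)‖_F²/3] → 0`: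
the own-projection products forget the window-start velocity (`‖Aᵢ‖_F² ≈ 3 (2/3)^{#own collisions}`
for non-degenerate normals; toy j008306: `|w_c|²` decays by `0.66` per lag). This is where the line
USES H1: a collision-free row has `ipr = 9` (`ipr_of_collisionCount_eq_zero`), coplanar own normals
freeze a velocity component of the sphere AND of its row (`reflectVel_of_inner_eq_zero`), so H1
excludes the degenerate cases exactly. Why it might fail: `M_ii = Aᵢ + (loop-returned weight)`, so
`‖Aᵢ‖ → 0` is not literally implied by H1 (triage r1-1 doubt (a)); the generic case needs one-step
non-degeneracy of the realised normals or a ring estimate, N-uniformly along the non-equilibrium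
law. -/
theorem stub_memory : MemoryLoss := by
  sorry

/-- STUB 5 (REDUCTION; analysis / measure theory, TRUE, L). For nice profiles, `0 < σ ≤ 1/2` (local
Gibbs laws are probability measures: `isProbabilityMeasure_localGibbsLaw`), a flow family with H2
and an admissible kernel family: if on every admissible window grid the memory vanishes in time
average and the windowed kick contraction holds, then C holds for this kernel family. Proof sketch
(docstring of the line card, §Stubs): with `b_k = sup_{[kΔ_N,(k+1)Δ_N]} X_N` the contraction gives
`b_k ≤ c · max(b_{k-1}, b_k) + R_k`, `R_k = K G_N(k-1) + ε_N`, hence (all `b_k ≤ B < ∞`)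
`b_k ≤ c^k B + Σ_{i≤k} c^{k-i} R_i` and `∫₀ᵗ X_N ds ≤ Δ_N Σ_k b_k ≤ (Δ_N B + K Δ_N Σ_j G_N(j) + t ε_N)/(1-c)
→ 0`; then `E ∫₀ᵗ∫ₓ aniso(μ_x) → 0` gives the block traceless second moments in `L¹ₜ,ₓ` (quadratic
tests, recentring error quadratic in the first-moment defect) and the truncated third moments, the
velocity tails of `D²`, `|q|²` and the `L¹ → L²` interpolation being paid in time-INTEGRATED form by
H2 (`∫ₓ D² ≤ (∫ₓ|D|)^{1/2} (C_σ m₆)^{1/2}`, hard-core density cap `ρ̄ ≤ 8C/σ³`); measurability of the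
block functionals along the flow from `HardSphereFlow.measurable_flow`. -/
theorem stub_reduction : Reduction := by
  sorry

/-! ## Composition -/

/-- The five stub STATEMENTS imply the crux in its unfolded form (the right-hand side of
`adaptedWeightCLT_iff`) by pure logic: `σ₀ := min (min σ_contraction σ_memory) (1/2)`; H1 feeds
`KickContraction` and `MemoryLoss`, H2 feeds `KickContraction` and `Reduction`. (This helper does
not mention the crux decl; the skeleton theorem below does.) -/
theorem adaptedWeightCLT_of_parts (hF : FrameLawAll) (hL : LinearSectorContraction)
    (hC : KickContraction) (hM : MemoryLoss) (hR : Reduction) :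
    ∀ (a₀ θ₀ : T3 → ℝ) (u₀ : T3 → V3), Continuous a₀ → Continuous θ₀ → Continuous u₀ →
      (∀ x, 0 < a₀ x) → (∀ x, 0 < θ₀ x) → ∃ σ₀ : ℝ, 0 < σ₀ ∧ ∀ σ : ℝ, 0 < σ → σ < σ₀ →
        ∀ Φ : Flows σ, DiffuseAt σ a₀ θ₀ u₀ Φ → TailsAt σ a₀ θ₀ u₀ Φ →
          ∀ (γ C : ℝ) (φ : ℕ → T3 → ℝ), 0 < γ → γ ≤ 1 / 15 →
            ((∀ N, Literature.Analysis.FunctionSpaces.Torus.IsSmooth (φ N)) ∧ (∀ N y, 0 ≤ φ N y) ∧ (∀ N, ∫ y, φ N y = 1) ∧ (∀ (N : ℕ) y, ((N : ℝ) + 1) ^ (-γ) ≤ Literature.Analysis.FluidPDE.Torus.euclidDist y 0 → φ N y = 0) ∧ (∀ (N : ℕ) y, φ N y ≤ C * ((N : ℝ) + 1) ^ (3 * γ)) ∧ (∀ (N : ℕ) y, ‖Literature.Analysis.FunctionSpaces.Torus.gradient (φ N) y‖ ≤ C * ((N : ℝ) + 1) ^ (4 * γ))) →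
            ClosureAt σ a₀ θ₀ u₀ Φ φ := by
  intro a₀ θ₀ u₀ ha hθ hu ha0 hθ0
  have hP : NiceProfiles a₀ θ₀ u₀ := ⟨ha, hθ, hu, ha0, hθ0⟩
  obtain ⟨σ₁, hσ₁, H1⟩ := hC hF hL a₀ θ₀ u₀ hP
  obtain ⟨σ₂, hσ₂, H2⟩ := hM hF a₀ θ₀ u₀ hP
  refine ⟨min (min σ₁ σ₂) (1 / 2), lt_min (lt_min hσ₁ hσ₂) (by norm_num), ?_⟩
  intro σ hσ hσlt Φ hD hT γ C φ hγ hγ' hadm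
  have h1 : σ < σ₁ := lt_of_lt_of_le hσlt ((min_le_left _ _).trans (min_le_left _ _))
  have h2 : σ < σ₂ := lt_of_lt_of_le hσlt ((min_le_left _ _).trans (min_le_right _ _))
  have h3 : σ ≤ 1 / 2 := (lt_of_lt_of_le hσlt (min_le_right _ _)).le
  have hK : AdmissibleKernel γ C φ := ⟨hγ, hγ', hadm⟩
  exact hR a₀ θ₀ u₀ hP σ hσ h3 Φ hT γ C φ hK fun Δ hΔ t ht =>
    ⟨H2 σ hσ h2 Φ hD Δ hΔ t ht, H1 σ hσ h1 Φ hD hT γ C φ hK Δ hΔ t ht⟩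

/-- **The skeleton concludes the crux BY NAME.** `CollisionIsometryCLT.AdaptedWeightCLT`
(stmt-AtomisticToContinuum-12949) from the five registered stubs `stub_frame`, `stub_linearSector`,
`stub_kickContraction`, `stub_memory`, `stub_reduction` (no other hypothesis; `sorry` lives only in
the stubs — once they are proved this IS the crux proof; the crux's `let M; let ipr` hypotheses and
`let ρb …` conclusion are `DiffuseAt` / `TailsAt` / `ClosureAt` definitionally, `adaptedWeightCLT_iff`). -/
theorem AdaptedWeightCLT_of :
    Summit.AtomisticToContinuum.HydrodynamicLimit.Theses.CollisionIsometryCLT.AdaptedWeightCLT :=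
  adaptedWeightCLT_iff.2 (adaptedWeightCLT_of_parts stub_frame stub_linearSector stub_kickContraction
    stub_memory stub_reduction)

end

end Summit.AtomisticToContinuum.HydrodynamicLimit.Cruxes.AdaptedWeightCLT.TaggedFrameSectorContraction
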